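import Mathlib
import HarnessLib

/-!
# `Z_mix(n)` and the AND-gadget / diagonal-read vocabulary of the xc-division line (definitions only)

Definitions file (objects a line posits; review lane) for the Theorems-side port of §9–§10 of val-idea-7 g9's crux workfile
`Cruxes/NNLinearDegreeCofactorHard/Lines/xc_division.lean` rev 4.1 (@61de3b6b78b4; critic val-idea-crit-3 g3 by-name PASS
2026-08-28 12:00Z; director-valiant g13 R232 (a) / R233 (b) / R234 (d): port hand val-port-2 g1).  VERBATIM copies of the
workfile's definitions, nothing asserted:

* `eSym n k l` — the symmetric off-diagonal unit matrix `E^s_{kl}` as a function on index pairs; `zmixDir n (k,l,m)` — the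
  generator direction `E^s_{kl} − E^s_{km}` (`l < m`, `k ∉ {l,m}`, else `0`); `zmixPt n ε` — the signed generator sums;
  ★ `Zmix n` — crit-3's zonotope `Z_mix(n) = Σ_g [−1,1]·D_g = conv {Σ_g ε_g D_g}`, the parked passenger of the line's
  open problem COR-MINKOWSKI («`xc(COR(K_n) + Q) ≥ T c n` for every polytope `Q`»).
* the exposed-face / diagonal-shadow certificate (PROP E) vocabulary for an injective slot assignment
  `ι : Fin m ⊕ (Fin m × Fin m) ↪ Fin n`: `uSlot`, `wSlot` (vertex / pair slots), `eFun` (elementary functional `E_{pq}`),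
  `gadFun`, ★ `andDir` (the AND-gadget direction `Σ_{(i,j)} (−E_{u_i u_j} + 2E_{u_i w_ij} + 2E_{u_j w_ij} − 3E_{w_ij w_ij})`),
  `pen` (the Boolean penalty `xy − 2xz − 2yz + 3z`), `slotVal`, `liftBool` (lift of `b' ∈ {0,1}^m` to the slots), `slotPos`,
  ★ `diagRead` (the linear read of the diagonal slots `ℝ^{n×n} → ℝ^{m×m}`), `zmixArgmax` (the sign pattern maximising a
  functional over the generators).

The theorems (`Z_mix` is off-diagonal; the gadget face of `COR(K_n)` read on the diagonal is `COR(K_m)`; PROP E; ★★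
`xc(COR(K_n) + Z_mix(n)) > 2^((log₂ n + c)^c)` eventually) are in the sibling proof files `…XcDivisionZmixFace.lean` /
`…XcDivisionZmixCorHard.lean`.  HONEST FRAMING: these objects decide ONE passenger (`Z_mix`) of COR-MINKOWSKI; the LAW
(`∀ Q`), stmt-21181 `NNDivisionHard` and `VP ≠ VNP` are OPEN / NOT proved; nothing here is a summit statement.
-/

set_option autoImplicit false

-- the mandated summit-side namespace repeats a component by design (single-problem summit)
set_option linter.dupNamespace false

noncomputable section

open Matrix

namespace Summit.ValiantsHypothesis.ValiantsHypothesis.Theorems.FifoMatching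

namespace XcDivision

/-! ## `Z_mix(n)` -/

/-- the symmetric off-diagonal unit matrix `E^s_{kl}` (as a function on index pairs). -/
def eSym (n : ℕ) (k l : Fin n) : Fin n × Fin n → ℝ :=
  fun p => if (p.1 = k ∧ p.2 = l) ∨ (p.1 = l ∧ p.2 = k) then 1 else 0

/-- generator directions of `Z_mix(n)`, indexed by all triples `(k, l, m)`; the direction is `E^s_{kl} − E^s_{km}` when `l < m` and
`k ∉ {l, m}`, and `0` otherwise (zero generators do not change the zonotope). -/
def zmixDir (n : ℕ) (g : Fin n × Fin n × Fin n) : Fin n × Fin n → ℝ :=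
  if g.2.1 < g.2.2 ∧ g.1 ≠ g.2.1 ∧ g.1 ≠ g.2.2 then eSym n g.1 g.2.1 - eSym n g.1 g.2.2 else 0

/-- the signed generator sums `Σ_g ε_g · D_g`, `ε ∈ {±1}^G` — the vertex candidates of the zonotope. -/
def zmixPt (n : ℕ) (ε : Fin n × Fin n × Fin n → Bool) : Fin n × Fin n → ℝ :=
  ∑ g, (if ε g then (1 : ℝ) else -1) • zmixDir n g

/-- **`Z_mix(n)`** = the zonotope `Σ_g [−1,1]·D_g` = `conv {Σ_g ε_g D_g : ε ∈ {±1}^G}`. -/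
def Zmix (n : ℕ) : Set (Fin n × Fin n → ℝ) := convexHull ℝ (Set.range (zmixPt n))

/-! ## The AND-gadget / diagonal-read vocabulary -/

section Gadget

variable {m n : ℕ}

/-- vertex slot `u i`. -/
def uSlot (ι : Fin m ⊕ (Fin m × Fin m) ↪ Fin n) (i : Fin m) : Fin n := ι (Sum.inl i)

/-- pair slot `w (i, j)`. -/
def wSlot (ι : Fin m ⊕ (Fin m × Fin m) ↪ Fin n) (g : Fin m × Fin m) : Fin n := ι (Sum.inr g)

/-- the elementary functional `E_{pq}`: `E_{pq} · x = x (p, q)`. -/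
def eFun (n : ℕ) (p q : Fin n) : Fin n × Fin n → ℝ := Pi.single (p, q) 1

/-- the AND-gadget functional of the pair `g = (i, j)`: `−E_{u_i u_j} + 2E_{u_i w_g} + 2E_{u_j w_g} − 3E_{w_g w_g}`. -/
def gadFun (ι : Fin m ⊕ (Fin m × Fin m) ↪ Fin n) (g : Fin m × Fin m) : Fin n × Fin n → ℝ :=
  -eFun n (uSlot ι g.1) (uSlot ι g.2) + (2 : ℝ) • eFun n (uSlot ι g.1) (wSlot ι g)
    + (2 : ℝ) • eFun n (uSlot ι g.2) (wSlot ι g) - (3 : ℝ) • eFun n (wSlot ι g) (wSlot ι g)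

/-- **the AND-gadget direction** `C = Σ_g gadFun g`. -/
def andDir (ι : Fin m ⊕ (Fin m × Fin m) ↪ Fin n) : Fin n × Fin n → ℝ := ∑ g, gadFun ι g

/-- the Boolean penalty `pen(x,y,z) = xy − 2xz − 2yz + 3z`. -/
def pen (x y z : Bool) : ℝ :=
  (if x then 1 else 0) * (if y then 1 else 0) - 2 * ((if x then 1 else 0) * (if z then 1 else 0))
    - 2 * ((if y then 1 else 0) * (if z then 1 else 0)) + 3 * (if z then 1 else 0)

/-- slot values of `b' ∈ {0,1}^m`: `b'_i` at the vertex slot `i`, `b'_i b'_j` at the pair slot `(i, j)`. -/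
def slotVal (b' : Fin m → Bool) : Fin m ⊕ (Fin m × Fin m) → Bool :=
  Sum.elim b' fun g => b' g.1 && b' g.2

open Classical in
/-- the lift of `b' ∈ {0,1}^m` to `{0,1}^n` (slots get their values, unused positions `false`). -/
def liftBool (ι : Fin m ⊕ (Fin m × Fin m) ↪ Fin n) (b' : Fin m → Bool) : Fin n → Bool :=
  fun p => decide (∃ s, ι s = p ∧ slotVal b' s = true)

/-- the DIAGONAL position read for the coordinate `(i, j)` of `ℝ^{m×m}`: `(u_i, u_i)` if `i = j`, else `(w_ij, w_ij)`. -/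
def slotPos (ι : Fin m ⊕ (Fin m × Fin m) ↪ Fin n) : Fin m × Fin m → Fin n × Fin n
  | (i, j) => if i = j then (uSlot ι i, uSlot ι i) else (wSlot ι (i, j), wSlot ι (i, j))

/-- **the diagonal read** `ℝ^{n×n} → ℝ^{m×m}`, `x ↦ (x (slotPos (i,j)))_{(i,j)}` — a coordinate projection. -/
def diagRead (ι : Fin m ⊕ (Fin m × Fin m) ↪ Fin n) : (Fin n × Fin n → ℝ) →ₗ[ℝ] (Fin m × Fin m → ℝ) :=
  LinearMap.funLeft ℝ ℝ (slotPos ι)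

/-- the sign pattern maximising a functional `C` over the generators of `Z_mix(n)`. -/
def zmixArgmax (C : Fin n × Fin n → ℝ) : Fin n × Fin n × Fin n → Bool :=
  fun g => decide (0 ≤ C ⬝ᵥ zmixDir n g)

end Gadget

end XcDivision

end Summit.ValiantsHypothesis.ValiantsHypothesis.Theorems.FifoMatching

end
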